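import Summits.HubbardSuperconductivity.HubbardSuperconductivity.Theorems.TwSourcedCondensation.Negative.NormalFormsAndFrozenThreshold

/-!
# Crux `TwSourcedCondensation` (item `stmt-HubbardSuperconductivity-1697`): the frozen-threshold
obstruction from a FREE-cluster gap only

Sequel to `NormalFormsAndFrozenThreshold` (standing disprover, generation 2); no definition introduced.

* `log_partitionFn_source_sub_le_of_approxGap` — APPROXIMATE-gap version of the `β`-uniform cap: if
  `H ≥ E₁ + γ(1 - |ψ₀⟩⟨ψ₀|)` (any real `E₁`, `ψ₀` unit, `⟨ψ₀,Qψ₀⟩ = 0`) then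
  `log Z_β(H - hQ) - log Z_β(H) ≤ βh²‖Q‖²/γ + log dim + β(⟨ψ₀,Hψ₀⟩ - E₁)`: an approximate ground
  vector costs only `β(⟨ψ₀,Hψ₀⟩ - E₁)` in the exponent.
* `re_dotProduct_interaction_mulVec_nonneg` — `Σ_x n_{x↑}n_{x↓}` is a positive quadratic form;
  `hubbardTorusWith_eq_free_add` — `K_U = K_0 + U·Σ_x n_{x↑}n_{x↓}`.
* `twSourcedCondensation_false_frozenThreshold_of_freeGap` — granted a unique gapped ground vector of
  the FREE cluster `hubbardTorusWith 2 ℓ 1 0 μs` (an explicit free-fermion statement; `ℓ = 2`,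
  `μs = -1/2`: the `k = 0` orbital doubly occupied, `γ = 1/2`), the crux with its threshold frozen at
  `L₀ := ℓ` is FALSE: the interacting cluster inherits the free gap inequality at cost `βUℓ²`, which the
  witness keeps `≤ 1` by running at the moderate temperature `β = 1/(ℓ²U)` (`h = ℓ√U`), where already
  `log β = log(1/(ℓ²U)) → ∞`. No Weyl perturbation theory and no interacting ground state are needed.

Tree: `rayleigh_source_ge_of_gap`, `le_groundEnergy_of_forall_rayleigh` (`FiniteVolumeResponseBounds`),
`groundEnergy_le_rayleigh_holds` (`FinDimSpectrumProofs`), `exp_neg_mul_groundEnergy_le_partitionFn`,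
`partitionFn_le_card_mul_exp` (`LiebFluxPhaseProofs`), `LiebThm1.numberOp_eq_diagonal`,
`dWaveSourceTorus_sub_free`, `norm_sum_numberOp_mul_numberOp_le` (`ThermalWedgeTwSourcedInertnessReduction`),
`exists_small_coupling` is not needed (five explicit smallness constraints on `U`).
-/

noncomputable section

namespace Summit.HubbardSuperconductivity.HubbardSuperconductivity.Theorems.TwSourcedCondensation.Negative

open Matrix Finset Literature.MathematicalPhysics.QuantumLattice Literature.Probability.LatticeModels
open Summit.HubbardSuperconductivity.HubbardSuperconductivity.Theorems
open scoped Matrix.Norms.L2Operator ComplexOrder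

section Abstract

variable {m : Type*} [Fintype m] [DecidableEq m]

/-- **Approximate-gap version of the `β`-uniform cap**: if `Re⟨φ,Hφ⟩ ≥ E₁ + γ(1 - |⟨ψ₀,φ⟩|²)` for
all unit `φ` (`ψ₀` unit, `γ > 0`, `E₁` any real) and `⟨ψ₀,Qψ₀⟩ = 0`, then for `β ≥ 0` and real `h`
`log Z_β(H - hQ) - log Z_β(H) ≤ βh²‖Q‖²/γ + log dim + β(Re⟨ψ₀,Hψ₀⟩ - E₁)`. [folklore] -/
theorem log_partitionFn_source_sub_le_of_approxGap {H Q : Matrix m m ℂ} (hH : H.IsHermitian)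
    (hQ : Q.IsHermitian) [Nonempty m] {ψ₀ : m → ℂ} (hψ₀ : star ψ₀ ⬝ᵥ ψ₀ = 1) {E₁ γ : ℝ} (hγ : 0 < γ)
    (hgap : ∀ φ : m → ℂ, star φ ⬝ᵥ φ = 1 →
      E₁ + γ * (1 - ‖star ψ₀ ⬝ᵥ φ‖ ^ 2) ≤ (star φ ⬝ᵥ H *ᵥ φ).re)
    (h1 : star ψ₀ ⬝ᵥ Q *ᵥ ψ₀ = 0) {β : ℝ} (hβ : 0 ≤ β) (h : ℝ) :
    Real.log (partitionFn β (H - (h : ℂ) • Q)).re - Real.log (partitionFn β H).re ≤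
      β * (h ^ 2 * ‖Q‖ ^ 2 / γ) + Real.log (Fintype.card m) +
        β * ((star ψ₀ ⬝ᵥ H *ᵥ ψ₀).re - E₁) := by
  have hHh := isHermitian_sub_smul hH hQ h
  have hE : E₁ - h ^ 2 * ‖Q‖ ^ 2 / γ ≤ (H - (h : ℂ) • Q).groundEnergy :=
    le_groundEnergy_of_forall_rayleigh hHh (rayleigh_source_ge_of_gap hψ₀ hγ hgap h1 h)
  have hE0 : H.groundEnergy ≤ (star ψ₀ ⬝ᵥ H *ᵥ ψ₀).re := groundEnergy_le_rayleigh_holds hH ψ₀ hψ₀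
  have hD : (0 : ℝ) < Fintype.card m := by exact_mod_cast Fintype.card_pos
  have hup := partitionFn_le_card_mul_exp hHh hβ
  have hZh : 0 < (partitionFn β (H - (h : ℂ) • Q)).re := partitionFn_re_pos hHh β
  have hup' := Real.log_le_log hZh hup
  rw [Real.log_mul hD.ne' (Real.exp_pos _).ne', Real.log_exp] at hup'
  have hlow := exp_neg_mul_groundEnergy_le_partitionFn hH β
  have hlow' := Real.log_le_log (Real.exp_pos _) hlow
  rw [Real.log_exp] at hlow'
  have hmono : -(β * (H - (h : ℂ) • Q).groundEnergy) ≤ -(β * (E₁ - h ^ 2 * ‖Q‖ ^ 2 / γ)) := by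
    have := mul_le_mul_of_nonneg_left hE hβ
    linarith
  have hmono' : β * H.groundEnergy ≤ β * (star ψ₀ ⬝ᵥ H *ᵥ ψ₀).re := mul_le_mul_of_nonneg_left hE0 hβ
  linarith

end Abstract

/-- One on-site repulsion term `n_{x↑} n_{x↓}` is a `0/1`-diagonal matrix, hence a positive
quadratic form. [folklore] -/
theorem re_dotProduct_numberOp_mul_numberOp_mulVec_nonneg {Λ : Type*} [LinearOrder Λ] [Fintype Λ]
    (x : Λ) (φ : Fock (Orb Λ)) :
    0 ≤ (star φ ⬝ᵥ (numberOp x 0 * numberOp x 1) *ᵥ φ).re := by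
  set d : Finset (Orb Λ) → ℂ := fun s =>
    (if orb x 0 ∈ s then (1 : ℂ) else 0) * (if orb x 1 ∈ s then (1 : ℂ) else 0) with hd
  have hdiag : (numberOp x 0 * numberOp x 1 : Matrix (Finset (Orb Λ)) (Finset (Orb Λ)) ℂ) = diagonal d := by
    rw [LiebThm1.numberOp_eq_diagonal, LiebThm1.numberOp_eq_diagonal, diagonal_mul_diagonal]
  have hds : ∀ s, d s = ((if orb x 0 ∈ s ∧ orb x 1 ∈ s then (1 : ℝ) else 0 : ℝ) : ℂ) := by
    intro s
    by_cases h0 : orb x 0 ∈ s <;> by_cases h1 : orb x 1 ∈ s <;> simp [hd, h0, h1]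
  rw [hdiag, dotProduct, Complex.re_sum]
  refine Finset.sum_nonneg fun s _ => ?_
  rw [mulVec_diagonal, Pi.star_apply, hds s, Complex.star_def,
    show (starRingEnd ℂ) (φ s) * (((if orb x 0 ∈ s ∧ orb x 1 ∈ s then (1 : ℝ) else 0 : ℝ) : ℂ) * φ s) =
      (((if orb x 0 ∈ s ∧ orb x 1 ∈ s then (1 : ℝ) else 0 : ℝ) : ℂ)) * (φ s * (starRingEnd ℂ) (φ s)) by ring,
    Complex.mul_conj, ← Complex.ofReal_mul, Complex.ofReal_re]
  exact mul_nonneg (by split_ifs <;> norm_num) (Complex.normSq_nonneg _)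

/-- The on-site repulsion `Σ_x n_{x↑} n_{x↓}` is a positive quadratic form. [folklore] -/
theorem re_dotProduct_interaction_mulVec_nonneg {Λ : Type*} [LinearOrder Λ] [Fintype Λ]
    (φ : Fock (Orb Λ)) :
    0 ≤ (star φ ⬝ᵥ (∑ x : Λ, numberOp x 0 * numberOp x 1) *ᵥ φ).re := by
  rw [Matrix.sum_mulVec, dotProduct_sum, Complex.re_sum]
  exact Finset.sum_nonneg fun x _ => re_dotProduct_numberOp_mul_numberOp_mulVec_nonneg x φ

/-- Switching the repulsion on: `K_U = K_0 + U·Σ_x n_{x↑}n_{x↓}`. [folklore] -/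
theorem hubbardTorusWith_eq_free_add (ℓ : ℕ) [NeZero ℓ] (U μ : ℝ) :
    hubbardTorusWith 2 ℓ 1 U μ =
      hubbardTorusWith 2 ℓ 1 0 μ + (U : ℂ) • ∑ x : FermionTorus 2 ℓ, numberOp x 0 * numberOp x 1 := by
  have h := dWaveSourceTorus_sub_free ℓ U μ 0
  rw [dWaveSourceTorus_zero, dWaveSourceTorus_zero, sub_eq_iff_eq_add'] at h
  rw [h, add_comm]

/-- **The frozen threshold is impossible already from the FREE-cluster gap**: under
the free-cluster gap hypothesis (inline: unique gapped ground vector `ψ₀` of `hubbardTorusWith 2 ℓ 1 0 μs`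
in projector form, `⟨ψ₀,(Δ_d+Δ_d†)ψ₀⟩ = 0`) with `μs ∈ (-4,0)`, the crux with the FROZEN threshold
`L₀ := ℓ` is FALSE. The interacting
cluster inherits the free gap inequality with `E₁ = ⟨ψ₀,K_0ψ₀⟩` because `Σ_x n_{x↑}n_{x↓} ≥ 0`, at the
price `βU⟨ψ₀,Wψ₀⟩ ≤ βUℓ²` in the exponent (`log_partitionFn_source_sub_le_of_approxGap`); the witness
therefore runs at the MODERATE temperature `β = 1/(ℓ²U)` (inside `[1, e^{a/U}]` for small `U`) with
`h = β^{-1/2} = ℓ√U`: response `≤ (‖Q‖²/γ + log dim + 1)/(βℓ²)`, floor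
`≥ (c((1/2)log β - log 2) - C)/β`, and `log β = log(1/(ℓ²U)) → ∞`. [folklore] -/
theorem twSourcedCondensation_false_frozenThreshold_of_freeGap (ℓ : ℕ) [NeZero ℓ] {μs γ : ℝ}
    (hμ1 : -4 < μs) (hμ2 : μs < 0) (hγ : 0 < γ)
    (hyp : ∃ ψ₀ : Fock (Orb (FermionTorus 2 ℓ)), star ψ₀ ⬝ᵥ ψ₀ = 1 ∧
      star ψ₀ ⬝ᵥ (pairField dWaveFormFactor ℓ + (pairField dWaveFormFactor ℓ)ᴴ) *ᵥ ψ₀ = 0 ∧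
      ∀ φ : Fock (Orb (FermionTorus 2 ℓ)), star φ ⬝ᵥ φ = 1 →
        (star ψ₀ ⬝ᵥ (hubbardTorusWith 2 ℓ 1 0 μs) *ᵥ ψ₀).re + γ * (1 - ‖star ψ₀ ⬝ᵥ φ‖ ^ 2) ≤
          (star φ ⬝ᵥ (hubbardTorusWith 2 ℓ 1 0 μs) *ᵥ φ).re) :
    ¬ (∀ μ₁ μ₂ : ℝ, -4 < μ₁ → μ₁ ≤ μ₂ → μ₂ < 0 → ∃ U₀ a c C h₀ : ℝ, 0 < U₀ ∧ 0 < a ∧ 0 < c ∧ 0 < C ∧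
      0 < h₀ ∧ ∀ U : ℝ, 0 < U → U ≤ U₀ → ∀ β : ℝ, 1 ≤ β → β ≤ Real.exp (a / U) →
      ∀ μ ∈ Set.Icc μ₁ μ₂, ∀ (L : ℕ) [NeZero L], ℓ ≤ L → ∀ h : ℝ, |h| ≤ h₀ →
        c * h ^ 2 * Real.log (1 / (|h| + 1 / β)) - C * h ^ 2 ≤
          Real.log (partitionFn β (dWaveSourceTorus L U μ h)).re / (β * (L : ℝ) ^ 2) -
            Real.log (partitionFn β (dWaveSourceTorus L U μ 0)).re / (β * (L : ℝ) ^ 2)) := by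
  intro H
  obtain ⟨ψ₀, hψ₀, hψQ, hgap0⟩ := hyp
  -- opaque names for the three matrices (no `set`: abstracting inside the large hypotheses is costly)
  obtain ⟨Q, hQdef⟩ : ∃ Q, Q = pairField dWaveFormFactor ℓ + (pairField dWaveFormFactor ℓ)ᴴ := ⟨_, rfl⟩
  obtain ⟨W, hWdef⟩ : ∃ W : Matrix (Finset (Orb (FermionTorus 2 ℓ))) (Finset (Orb (FermionTorus 2 ℓ))) ℂ,
      W = ∑ x : FermionTorus 2 ℓ, numberOp x 0 * numberOp x 1 := ⟨_, rfl⟩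
  obtain ⟨K0, hK0def⟩ : ∃ K0, K0 = hubbardTorusWith 2 ℓ 1 0 μs := ⟨_, rfl⟩
  rw [← hQdef] at hψQ
  simp only [← hK0def] at hgap0
  obtain ⟨U₀, a, c, C, h₀, hU₀, ha, hc, hC, hh₀, H⟩ := H μs μs hμ1 le_rfl hμ2
  have hℓ : (0 : ℝ) < (ℓ : ℝ) ^ 2 := cast_sq_pos_of_neZero ℓ
  set ω : ℝ := (ℓ : ℝ) ^ 2 with hω
  have hωpos : 0 < ω := hℓ
  -- constants of the response bound
  set A : ℝ := ‖Q‖ ^ 2 / γ with hA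
  set Dl : ℝ := Real.log (Fintype.card (Finset (Orb (FermionTorus 2 ℓ)))) with hDl
  have hA0 : 0 ≤ A := by positivity
  have hDl0 : 0 ≤ Dl := Real.log_nonneg (by exact_mod_cast Nat.one_le_iff_ne_zero.2 Fintype.card_ne_zero)
  have hlog2 : 0 < Real.log 2 := Real.log_pos one_lt_two
  -- the target size of `log β`
  set M₁ : ℝ := 2 * (A + Dl + 1 + ω * C + ω * c * Real.log 2) / (ω * c) with hM₁
  have hM₁0 : 0 ≤ M₁ := by positivity
  -- the coupling: small enough for five constraints
  set ε : ℝ := min (min (1 / ω) (h₀ ^ 2 / ω)) (min (a ^ 2 / 4) (Real.exp (-M₁ - 1) / ω)) with hε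
  have hεpos : 0 < ε := by positivity
  set U : ℝ := min U₀ ε with hU
  have hUpos : 0 < U := lt_min hU₀ hεpos
  have hUU₀ : U ≤ U₀ := min_le_left _ _
  have hUε : U ≤ ε := min_le_right _ _
  have hU1 : U ≤ 1 / ω := hUε.trans ((min_le_left _ _).trans (min_le_left _ _))
  have hU2 : U ≤ h₀ ^ 2 / ω := hUε.trans ((min_le_left _ _).trans (min_le_right _ _))
  have hU3 : U ≤ a ^ 2 / 4 := hUε.trans ((min_le_right _ _).trans (min_le_left _ _))
  have hU4 : U ≤ Real.exp (-M₁ - 1) / ω := hUε.trans ((min_le_right _ _).trans (min_le_right _ _))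
  -- the temperature `β = 1/(ωU)` and the source `h = √(ωU)`
  set β : ℝ := 1 / (ω * U) with hβ
  have hωU : 0 < ω * U := mul_pos hωpos hUpos
  have hβpos : 0 < β := one_div_pos.2 hωU
  have hβ1 : 1 ≤ β := by
    rw [hβ, le_div_iff₀ hωU, one_mul]
    calc ω * U ≤ ω * (1 / ω) := mul_le_mul_of_nonneg_left hU1 hωpos.le
      _ = 1 := mul_one_div_cancel hωpos.ne'
  have hβexp : β ≤ Real.exp (a / U) := by
    -- `1/(ωU) ≤ 1/U ≤ (a/(2U))² ≤ e^{a/U}` for `U ≤ a²/4`, `ω ≥ 1`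
    have hω1 : 1 ≤ ω := by
      rw [hω]; exact_mod_cast Nat.one_le_pow _ _ (Nat.pos_of_ne_zero (NeZero.ne ℓ))
    have step1 : β ≤ 1 / U := by
      rw [hβ]; exact one_div_le_one_div_of_le hUpos (le_mul_of_one_le_left hUpos.le hω1)
    have step2 : 1 / U ≤ (a / (2 * U)) ^ 2 := by
      rw [div_pow, div_le_div_iff₀ hUpos (by positivity)]
      nlinarith
    have step3 : (a / (2 * U)) ^ 2 ≤ Real.exp (a / U) := by
      have e1 : a / (2 * U) ≤ Real.exp (a / (2 * U)) := by
        linarith [Real.add_one_le_exp (a / (2 * U))]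
      have e2 : 0 ≤ a / (2 * U) := by positivity
      calc (a / (2 * U)) ^ 2 ≤ Real.exp (a / (2 * U)) ^ 2 := pow_le_pow_left₀ e2 e1 2
        _ = Real.exp (a / U) := by rw [sq, ← Real.exp_add]; congr 1; ring
    exact step1.trans (step2.trans step3)
  set h : ℝ := Real.sqrt (ω * U) with hh
  have hhpos : 0 < h := Real.sqrt_pos.2 hωU
  have hh2 : h ^ 2 = ω * U := Real.sq_sqrt hωU.le
  have hh2β : h ^ 2 * β = 1 := by rw [hh2, hβ, mul_one_div_cancel hωU.ne']
  have hβinv : 1 / β = h ^ 2 := by rw [hβ, one_div_one_div, hh2]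
  have hhle1 : h ≤ 1 := by
    rw [← Real.sqrt_one, hh]; refine Real.sqrt_le_sqrt ?_
    calc ω * U ≤ ω * (1 / ω) := mul_le_mul_of_nonneg_left hU1 hωpos.le
      _ = 1 := mul_one_div_cancel hωpos.ne'
  have hhh₀ : |h| ≤ h₀ := by
    rw [abs_of_pos hhpos, ← Real.sqrt_sq hh₀.le, hh]
    refine Real.sqrt_le_sqrt ?_
    calc ω * U ≤ ω * (h₀ ^ 2 / ω) := mul_le_mul_of_nonneg_left hU2 hωpos.le
      _ = h₀ ^ 2 := mul_div_cancel₀ _ hωpos.ne'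
  have key := H U hUpos hUU₀ β hβ1 hβexp μs ⟨le_rfl, le_rfl⟩ ℓ le_rfl h hhh₀
  -- the approximate-gap bound for `K_U = K0 + U W`
  have hKU : hubbardTorusWith 2 ℓ 1 U μs = K0 + (U : ℂ) • W := by
    rw [hK0def, hWdef]; exact hubbardTorusWith_eq_free_add ℓ U μs
  have hK := isHermitian_hubbardTorusWith ℓ 1 U μs
  have hQh : Q.IsHermitian := by rw [hQdef]; exact isHermitian_pairField_add_conjTranspose ℓ
  have hgapU : ∀ φ : Fock (Orb (FermionTorus 2 ℓ)), star φ ⬝ᵥ φ = 1 →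
      (star ψ₀ ⬝ᵥ K0 *ᵥ ψ₀).re + γ * (1 - ‖star ψ₀ ⬝ᵥ φ‖ ^ 2) ≤
        (star φ ⬝ᵥ (hubbardTorusWith 2 ℓ 1 U μs) *ᵥ φ).re := by
    intro φ hφ
    have hW := re_dotProduct_interaction_mulVec_nonneg (Λ := FermionTorus 2 ℓ) φ
    rw [← hWdef] at hW
    rw [hKU, add_mulVec, dotProduct_add, Complex.add_re, smul_mulVec, dotProduct_smul, smul_eq_mul,
      Complex.re_ofReal_mul]
    have := hgap0 φ hφ
    nlinarith [mul_nonneg hUpos.le hW]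
  have bound := log_partitionFn_source_sub_le_of_approxGap hK hQh hψ₀ hγ hgapU hψQ hβpos.le h
  -- the interaction cost `β U ⟨ψ₀, W ψ₀⟩ ≤ β U ω = 1`
  have hcost : (star ψ₀ ⬝ᵥ (hubbardTorusWith 2 ℓ 1 U μs) *ᵥ ψ₀).re - (star ψ₀ ⬝ᵥ K0 *ᵥ ψ₀).re ≤ U * ω := by
    rw [hKU, add_mulVec, dotProduct_add, Complex.add_re, smul_mulVec, dotProduct_smul, smul_eq_mul,
      Complex.re_ofReal_mul, add_sub_cancel_left]
    refine mul_le_mul_of_nonneg_left ?_ hUpos.le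
    have hnW : ‖W‖ ≤ ω := by
      have := norm_sum_numberOp_mul_numberOp_le (Λ := FermionTorus 2 ℓ)
      rw [card_fermionTorus_two] at this
      rw [hω, hWdef]; exact_mod_cast this
    calc (star ψ₀ ⬝ᵥ W *ᵥ ψ₀).re ≤ ‖star ψ₀ ⬝ᵥ W *ᵥ ψ₀‖ := Complex.re_le_norm _
      _ ≤ eucNorm ψ₀ * eucNorm (W *ᵥ ψ₀) := norm_star_dotProduct_le _ _
      _ ≤ 1 * (‖W‖ * 1) := by
          rw [eucNorm_eq_one hψ₀]
          refine mul_le_mul_of_nonneg_left ?_ zero_le_one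
          simpa [eucNorm_eq_one hψ₀] using eucNorm_mulVec_le W ψ₀
      _ ≤ ω := by linarith
  have hden : 0 < β * (ℓ : ℝ) ^ 2 := mul_pos hβpos hℓ
  have hR : Real.log (partitionFn β (dWaveSourceTorus ℓ U μs h)).re / (β * (ℓ : ℝ) ^ 2) -
      Real.log (partitionFn β (dWaveSourceTorus ℓ U μs 0)).re / (β * (ℓ : ℝ) ^ 2) ≤ (A + Dl + 1) * h ^ 2 / ω := by
    have hKh' : dWaveSourceTorus ℓ U μs h = hubbardTorusWith 2 ℓ 1 U μs - (h : ℂ) • Q := by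
      rw [hQdef]; rfl
    rw [← sub_div, div_le_iff₀ hden, dWaveSourceTorus_zero, hKh']
    refine bound.trans ?_
    have hβU : β * (U * ω) = 1 := by rw [hβ, mul_comm U ω, one_div_mul_cancel hωU.ne']
    have e1 : β * (h ^ 2 * ‖Q‖ ^ 2 / γ) = A := by
      rw [hA, ← mul_div_assoc, ← mul_assoc, mul_comm β, hh2β, one_mul]
    have hℓ0 : (ℓ : ℝ) ≠ 0 := by exact_mod_cast NeZero.ne ℓ
    have e3 : (A + Dl + 1) * h ^ 2 / ω * (β * (ℓ : ℝ) ^ 2) = A + Dl + 1 := by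
      rw [hh2, hβ, hω]
      field_simp
    have hcost' := mul_le_mul_of_nonneg_left hcost hβpos.le
    rw [hβU] at hcost'
    rw [e3]
    linarith [e1]
  -- the floor at `h`
  have hlog : Real.log β / 2 - Real.log 2 ≤ Real.log (1 / (|h| + 1 / β)) := by
    rw [abs_of_pos hhpos, hβinv]
    have hsq' : h ^ 2 ≤ h := by rw [sq]; exact mul_le_of_le_one_left hhpos.le hhle1
    have hsum' : h + h ^ 2 ≤ 2 * h := by linarith
    have hpos' : 0 < h + h ^ 2 := by positivity
    have hlogh : Real.log h = -(Real.log β / 2) := by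
      have : Real.log (h ^ 2) = -Real.log β := by rw [← hβinv, one_div, Real.log_inv]
      rw [Real.log_pow] at this
      push_cast at this
      linarith
    calc Real.log β / 2 - Real.log 2 = Real.log (1 / (2 * h)) := by
          rw [one_div, Real.log_inv, Real.log_mul two_ne_zero hhpos.ne', hlogh]; ring
      _ ≤ Real.log (1 / (h + h ^ 2)) :=
          Real.log_le_log (by positivity) (one_div_le_one_div_of_le hpos' hsum')
  -- `log β ≥ M₁ + 1`
  have hlogβ : M₁ + 1 ≤ Real.log β := by
    have h1 : ω * U ≤ Real.exp (-M₁ - 1) := by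
      calc ω * U ≤ ω * (Real.exp (-M₁ - 1) / ω) := mul_le_mul_of_nonneg_left hU4 hωpos.le
        _ = Real.exp (-M₁ - 1) := mul_div_cancel₀ _ hωpos.ne'
    have h2 : Real.log (ω * U) ≤ -M₁ - 1 := by
      rw [← Real.log_exp (-M₁ - 1)]; exact Real.log_le_log hωU h1
    rw [hβ, one_div, Real.log_inv]
    linarith
  -- compare: floor `h²(c(log β/2 - log 2) - C) ≤ response ≤ (A + Dl + 1) h²/ω`
  have hh2pos : 0 < h ^ 2 := by positivity
  have step : c * h ^ 2 * (Real.log β / 2 - Real.log 2) - C * h ^ 2 ≤ (A + Dl + 1) * h ^ 2 / ω := by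
    have := mul_le_mul_of_nonneg_left hlog (le_of_lt (mul_pos hc hh2pos))
    linarith
  have step2 : c * (Real.log β / 2 - Real.log 2) - C ≤ (A + Dl + 1) / ω := by
    have e : (A + Dl + 1) * h ^ 2 / ω = (A + Dl + 1) / ω * h ^ 2 := by ring
    rw [e] at step
    by_contra hcon
    push Not at hcon
    have := mul_lt_mul_of_pos_left hcon hh2pos
    linarith
  -- but `log β ≥ M₁ + 1` makes the floor exceed the cap
  have hω0 : ω ≠ 0 := hωpos.ne'
  have hc0 : c ≠ 0 := hc.ne'
  have hcM : c * M₁ / 2 = (A + Dl + 1) / ω + C + c * Real.log 2 := by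
    rw [hM₁]
    field_simp
  have h1 : c * (M₁ + 1) ≤ c * Real.log β := mul_le_mul_of_nonneg_left hlogβ hc.le
  linarith only [hcM, h1, step2, hc]


end Summit.HubbardSuperconductivity.HubbardSuperconductivity.Theorems.TwSourcedCondensation.Negative
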